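import Summits.CriticalPhenomena.PercolationContinuityZ3.Theorems.PercNearOneGluingNoHeavyLowerTailMajorityGluingTypeTableFixedMCover
import HarnessLib

/-!
# The fixed-`M` window programme in the kernel: the CHAIN LEMMA (grid points ⟹ the window statement)
(lane prim-rate, constants-miner 1, gen 29; KERNEL-WINDOW.md §3 item 5, §4 (3)/(7); NEXT-g29 item 2)

Support file for the closed crux `NoHeavyLowerTail` (stmt-CriticalPhenomena-4575), majority-gluing line; continuation of
`…TypeTableFixedMCover` (`SymLaw`, `cover`).  A window POINT is a theorem `SymLaw k M x → E x ≤ V_k` (every law of the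
symmetric (4,3) programme at hub weights `0 < M ≤ 2^{-k/32}`; assembled from 64 `checkFMB` certificates by `cover`).  A CHAIN is
a list `[(k₀,V₀), (k₁,V₁), …, (k_n,V_n)]` of points with `k₀ < k₁ < …` such that each point reaches the next one,
`V_i/(1+V_i) ≤ 2^{-k_{i+1}/32}`, and the last one reaches the bottom `m`: `V_n/(1+V_n) ≤ m`.  Then for every law with the
symmetric hypotheses at ANY hub weight `M ∈ [m, 2^{-k₀/32}]`:  **`(1 − M)·E(x) ≤ M`**, i.e. `E f ≤ δ₁/(1 − M)` in the lane's
normalisation `E = E f/δ₁ − 1` — the window statement of CONVEX-BOOTSTRAP.md §5 / BENCH M1-WINDOW on `[m, 2^{-k₀/32}]`.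

* `SymLaw.of_le` — the hypotheses are monotone in the grid index (`SymLaw k M x`, `M ≤ 2^{-k'/32}` ⟹ `SymLaw k' M x`);
* `grid_point_ge` — the rational lower bracket `(ETAU^k)⁻¹ ≤ 2^{-k/32}` (`ETAU ≥ 2^{1/32}`, `…TypeTableFixedMGrid`);
* `chainOK` — the computable check of a chain against a rational bottom `m` (pure `ℚ`, one `decide`);
* **`chain_sound`** — points + `chainOK` ⟹ the window statement on `[m, 2^{-k₀/32}]`.

No percolation, no sorries.  [cite: VandenbergHaggstromKahn2005, Thm. 1.3 (p. 6)]
-/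

namespace Summit.CriticalPhenomena.PercolationContinuityZ3.Theorems

namespace HubOnly
namespace TypeTable

open DType

/-- The chain check against a rational bottom `m`: every point reaches the next grid point of the chain
(`V_i·ETAU^{k_{i+1}} ≤ 1 + V_i`, i.e. `V_i/(1+V_i) ≤ ETAU^{-k_{i+1}} ≤ 2^{-k_{i+1}/32}`), all `V_i ≥ 0`, and the last point
reaches `m` (`V_n ≤ m·(1 + V_n)`). -/
def chainOK : List (ℕ × ℚ) → ℚ → Bool
  | [], _ => false
  | [(_, V)], m => decide (0 ≤ V) && decide (V ≤ m * (1 + V))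
  | (_, V) :: (k', V') :: rest, m => decide (0 ≤ V) && decide (V * ETAU ^ k' ≤ 1 + V) && chainOK ((k', V') :: rest) m

/-- Smoke test: the two-point chain `(137, 0.047135381) → (143, 0.0412)` against the bottom `m = 0.04`. -/
theorem chainOK_smoke : chainOK [(137, 47135381 / 1000000000), (143, 412 / 10000)] (4 / 100) = true := by
  decide +kernel

noncomputable section

/-- The symmetric hypotheses are monotone in the grid index: only `Mle` mentions `k`. -/
theorem SymLaw.of_le {k k' : ℕ} {M : ℝ} {x : DType → ℝ} (L : SymLaw k M x)
    (h : M ≤ (2 : ℝ) ^ (-(k' : ℝ) / 32)) : SymLaw k' M x where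
  nonneg := L.nonneg
  linRows := L.linRows
  norm := L.norm
  hub := L.hub
  rel := L.rel
  Mpos := L.Mpos
  Mle := h
  isoH := L.isoH
  isoR := L.isoR
  iso4 := L.iso4
  isoH4 := L.isoH4
  iso5 := L.iso5

/-- The rational lower bracket of a grid point: `(ETAU^k)⁻¹ ≤ 2^{-k/32}` (from `2^{1/32} ≤ ETAU`). -/
theorem grid_point_ge (k : ℕ) : (((ETAU ^ k)⁻¹ : ℚ) : ℝ) ≤ (2 : ℝ) ^ (-(k : ℝ) / 32) := by
  have h2 : (2 : ℝ) ^ ((1 : ℝ) / 32) ≤ ETAU := eta_bounds.2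
  have h0 : (0 : ℝ) < (2 : ℝ) ^ ((1 : ℝ) / 32) := by positivity
  have e : (2 : ℝ) ^ (-(k : ℝ) / 32) = (((2 : ℝ) ^ ((1 : ℝ) / 32)) ^ k)⁻¹ := by
    rw [← Real.rpow_natCast, ← Real.rpow_mul (by norm_num : (0 : ℝ) ≤ 2), ← Real.rpow_neg (by norm_num : (0 : ℝ) ≤ 2)]
    congr 1; ring
  rw [e]; push_cast
  exact inv_anti₀ (pow_pos h0 _) (pow_le_pow_left₀ h0.le h2 _)

/-- A grid bound is at most one: `M ≤ 2^{-k/32}` ⟹ `M ≤ 1`. -/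
theorem le_one_of_grid {k : ℕ} {M : ℝ} (h : M ≤ (2 : ℝ) ^ (-(k : ℝ) / 32)) : M ≤ 1 :=
  h.trans (Real.rpow_le_one_of_one_le_of_nonpos (by norm_num) (by
    have : (0 : ℝ) ≤ k := Nat.cast_nonneg k
    linarith))

/-- The step inequality: `E ≤ V`, `0 ≤ V`, `V ≤ m(1+V)`, `m ≤ M ≤ 1` ⟹ `(1 − M)·E ≤ M`. -/
theorem step_bound {Ex V m M : ℝ} (hE : Ex ≤ V) (hV : 0 ≤ V) (hm : V ≤ m * (1 + V)) (hmM : m ≤ M) (hM1 : M ≤ 1) :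
    (1 - M) * Ex ≤ M := by
  have h1 : V ≤ M * (1 + V) := hm.trans (by nlinarith)
  nlinarith

/-- **THE CHAIN LEMMA.**  If every point `(k_i, V_i)` of the chain is a window point (`SymLaw k_i M x → E x ≤ V_i`) and the
chain check against the bottom `m` passes, then `(1 − M)·E(x) ≤ M` for every law with the symmetric hypotheses at any hub
weight `M ∈ [m, 2^{-k₀/32}]` (`k₀` the first grid index of the chain). -/
theorem chain_sound : ∀ (rest : List (ℕ × ℚ)) (k : ℕ) (V m : ℚ),
    (∀ p ∈ ((k, V) :: rest), ∀ (M : ℝ) (x : DType → ℝ), SymLaw p.1 M x → E x ≤ (p.2 : ℝ)) →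
    chainOK ((k, V) :: rest) m = true →
    ∀ (M : ℝ) (x : DType → ℝ), SymLaw k M x → (m : ℝ) ≤ M → (1 - M) * E x ≤ M
  | [], k, V, m, hpts, hchk, M, x, L, hM => by
    simp only [chainOK, Bool.and_eq_true, decide_eq_true_eq] at hchk
    obtain ⟨hV0, hVm⟩ := hchk
    have hE := hpts (k, V) (by simp) M x L
    have hV0' : (0 : ℝ) ≤ V := by exact_mod_cast hV0
    have hVm' : (V : ℝ) ≤ (m : ℝ) * (1 + V) := by exact_mod_cast hVm
    exact step_bound hE hV0' hVm' hM (le_one_of_grid L.Mle)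
  | (k', V') :: rest, k, V, m, hpts, hchk, M, x, L, hM => by
    simp only [chainOK, Bool.and_eq_true, decide_eq_true_eq] at hchk
    obtain ⟨⟨hV0, hstep⟩, hrest⟩ := hchk
    by_cases hMk' : M ≤ (2 : ℝ) ^ (-(k' : ℝ) / 32)
    · exact chain_sound rest k' V' m (fun p hp => hpts p (List.mem_cons_of_mem _ hp)) hrest M x (L.of_le hMk') hM
    · push Not at hMk'
      have hE := hpts (k, V) (by simp) M x L
      have hV0' : (0 : ℝ) ≤ V := by exact_mod_cast hV0
      have hpos : (0 : ℚ) < ETAU ^ k' := pow_pos (lt_trans ETAL_pos (by decide +kernel)) _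
      have hVm : V ≤ (ETAU ^ k')⁻¹ * (1 + V) := by
        rw [le_inv_mul_iff₀ hpos]; linarith
      have hVm' : (V : ℝ) ≤ (((ETAU ^ k')⁻¹ : ℚ) : ℝ) * (1 + V) := by exact_mod_cast hVm
      exact step_bound hE hV0' hVm' ((grid_point_ge k').trans hMk'.le) (le_one_of_grid L.Mle)

end

end TypeTable
end HubOnly

end Summit.CriticalPhenomena.PercolationContinuityZ3.Theorems
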